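import Summits.NavierStokesRegularity.NavierStokesRegularity.Theses.FilamentSkeletonRss
import Summits.NavierStokesRegularity.NavierStokesRegularity.Theorems.FilamentSkeletonRssCoreGluingInvertibilitySplit
import Summits.NavierStokesRegularity.NavierStokesRegularity.Theorems.FilamentSkeletonRssCoreGluingSplit

/-!
# Crux `CoreGluingGivenInvertibility` (stmt-NavierStokesRegularity-17944) — line lead 0, skeleton v1 (re-checked by lead c1)

Crux (route `FilamentSkeletonRss`, rev 6):
`CoreGluingGivenInvertibility := CoreLinearInvertibility → CoreGluing`
`= CoreLinearInvertibility → SkeletonEquilibrium → RssProfileExists`.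

## Lead c1 re-check (2026-08-17T14:49Z; continuation seat `prover-line-…-17944-c1-0`)

Unchanged verdict, re-derived independently: `lean check` of this file rc 0, ONE sorry (`stub_notSkeletonEquilibrium`),
audit `proof-of-item` on `CoreGluingGivenInvertibility_of` (closed modulo that sorry).  Of the three disjuncts that
prove the typed crux — `¬ CoreLinearInvertibility`, `¬ SkeletonEquilibrium`, `RssProfileExists` — the first is out
(the sibling disprover's `Cruxes/CoreLinearInvertibility/Disproof.lean`: NO KILL, `σ_min(T|_V)` bounded away from `0`
and increasing in `R` in three independent codes; my own conjugation check: in `L²(G_λ⁻¹)`, `G_λ = (1−λ)/(4π)e^{−(1−λ)|x|²/4}`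
RADIAL, the transport part `v^G·∇` of `Λ_G` stays skew and only the Gaussian-localised compact part `(K∗·)·∇G` loses
skewness, so the `R`-size anti-dissipation is compact, not symbol-level — the WKB quasimode at `|x| ∼ √R` that WOULD
kill the bound in the anisotropic weight `e^{(1+λ)x₀²/4+(1−λ)x₁²/4}` (potential `−R(λ/2)Ω x₀x₁`, bracket `−λ/8π ≠ 0`)
does not exist in the crux's weight; the numerical-range top `½ − [√((1−λ)(1+3λ)) + (1−λ)]/4` of `L_λ` is reproduced;
and an explicit Lean counterexample would in any case need closed-form Biot–Savart integrals the tree cannot supply),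
the third is the open target (honest: `IsAncientMildSolution` + `HasTypeIDecay` make every
duality integral genuine for the rotated-DSS field generated by a `C²` slice), so the crux is `¬ SkeletonEquilibrium`
for every practical purpose — stmt-15400's negation programme (lead a1, line `zero_accretion_selection`, XL core stub
`stub_zeroAccretionShadowing` "no Lean route today").  New since lead 0: the disprover's landed negative lemma
`Theorems/CoreGluingGivenInvertibility/Negative/GaussianCoreRange.lean` (the linear input speaks only for elliptic
cross strain `λ < 1`, while every certified supercritical skeleton datum is hyperbolic, `λ = 2.16`, `1.17`) — a second,
independent reason why the constructive reading cannot even invoke its hypothesis at the skeletons on record.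

## What the payload line `Sketch` is

`payload.lines = [Sketch]`, skeleton path = evidence `20260817T103511Z-Sketch.lean` = tree
`Cruxes/CoreGluingGivenInvertibility/Ideator1Sketch.lean` (crux-ideate round 1, ideator 1).  `lean check`: rc 0,
0 sorries, audit `closes = []`, 13 orphans + 7 untagged `def … : Prop`.  It is a FIRST-LEMMA file of the two idea
cards `arnold-energy-fibre` and `core-choking`; it contains no `stub_*` and no `CoreGluingGivenInvertibility_of`,
so it is not a skeleton in the sense of L0/L1.  Its seven statements are

* `ArnoldSteadyIdentityGauss`, `ArnoldDiffusiveCoercivity`, `SteadyArnoldCoercivityGauss`,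
  `ArnoldSteadyIdentityStrained`, `SteadyArnoldCoercivityStrained` — identities / a-priori bounds for the
  LINEARISED PLANAR CORE OPERATOR (`linCoreOp lam ω̄ = L_λ − Λ_{ω̄}`) in Arnold's weight: variants and
  strengthenings of the HYPOTHESIS `CoreLinearInvertibility` of this crux (the sibling crux stmt-17973, whose own
  ideator-2 sketch already carries `XLamArnoldCoercivity`); they mention neither `SkeletonEquilibrium` nor
  `RssProfileExists`;
* `DragFreeFold`, `ChokedBranchWithDrag` — a quasi-one-dimensional ODE model of one dressed filament end (toy
  hydraulics of the `m = 0` far block of a gluing theorem).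

Every card of round 1 (all four, both ideators) states its transfer as
`C⁺ ∧ (quantitative GM-elliptic Hurwitz-confined skeleton BOX) → TransverseReduction-type gluing → RssProfileExists`,
i.e. for the RESTATED item of `Cruxes/CoreGluing/Restatement_c12.lean` (`CoreLinearInvertibility → TransverseReduction`,
hypothesis `SelectionBox`), never for the typed one: the typed hypothesis `SkeletonEquilibrium` (exact relative
equilibrium along SOME sequence Γ → ∞, α fixed before Γ, no non-degeneracy modulo rotation, no Γ-uniform bounds,
no accretion parameters) is consumed by no card.

## The two compositions of the typed crux that exist (both over TREE theorems)

1. CONSTRUCTIVE: `SelectionBox → TransverseReduction → CoreGluing` is the landed split glue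
   `Theorems.stub_coreGluingSplit` (p153006-family, statements inlined); with the linear input idle this gives the
   crux (`coreGluingGivenInvertibility_of_splitGlue` below).  Both hypotheses are the parent's registered stubs
   `stub_selectionBox` (K1-ball box: stub-blocked on stmt-15400's quantitative re-cut, parent leads a1/c4) and
   `stub_transverseReduction` (the 3-D viscous gluing modulo the N accretion modes, "K2q": crux-sized, parent leads
   a1/c4/c5 `promote-stub`).  The cards' lemmas feed the SECOND of these only (sectional `k = 0` block; `m = 0` far
   block).  A line for the typed crux through this composition therefore has, besides the card lemmas, exactly the
   parent's two crux-sized stubs — line `zero-accretion-selection` of stmt-15401 verbatim (dead c5, blocked c6–c11).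
2. VACUOUS: `¬ SkeletonEquilibrium → CoreGluingGivenInvertibility`
   (`Theorems.coreGluingGivenInvertibility_of_not_skeletonEquilibrium`, p151377).  Under the Type-I DSS Liouville wall
   and the linear input the crux IS `¬ SkeletonEquilibrium`
   (`Theorems.coreGluingGivenInvertibility_iff_not_skeletonEquilibrium_of_wall`).  `¬ SkeletonEquilibrium` is the
   target of stmt-15400's three registered negation lines (`kelvin_sonic_negation`, `mirror_point_negation`,
   `zero_accretion_selection` — the last driven by lead a1 of stmt-15400 since 2026-08-17T13:30Z; strategist s2:
   "crux very probably false as typed", credence 0.85–0.9).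

This skeleton registers composition 2 — the honest record of what the typed crux hinges on — with ONE stub,
`stub_notSkeletonEquilibrium`, crux-sized and owned upstream (no worker is briefed on it: it is stmt-15400's item).
The generic audit lemmas `lineObligation_iff` / `lineObligation_iff_of_wall` record, for an ARBITRARY package `P`
of lemmas a line might prove, what its last stub must be.
-/

set_option linter.dupNamespace false

namespace Summit.NavierStokesRegularity.NavierStokesRegularity.Cruxes.CoreGluingGivenInvertibility.Lead0

open Summit.NavierStokesRegularity.NavierStokesRegularity.Theses.FilamentSkeletonRss
open Summit.NavierStokesRegularity.NavierStokesRegularity.Theorems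

/-- **STUB (the only one; crux-sized, owned by stmt-NavierStokesRegularity-15400's negation lines).**
The filament skeleton statement `SkeletonEquilibrium` (exact relative equilibrium of the regularised Biot–Savart
law in the rotating Leray frame with supercritical stagnation stretching, at arbitrarily large circulation) is
false as typed.  [folklore] -/
theorem stub_notSkeletonEquilibrium : ¬ SkeletonEquilibrium := by
  sorry

/-- **Composition: the crux BY NAME, modulo the one stub** (tree p151377,
`coreGluingGivenInvertibility_of_not_skeletonEquilibrium`). [folklore] -/
theorem CoreGluingGivenInvertibility_of : CoreGluingGivenInvertibility :=
  coreGluingGivenInvertibility_of_not_skeletonEquilibrium stub_notSkeletonEquilibrium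

/-! ## Audit lemmas: what the last stub of ANY line for the typed crux is -/

/-- For any package `P` of lemmas a line proves (Arnold identities, choking ODE facts, …), the remaining
obligation `P → crux` is literally `P → CoreLinearInvertibility → (¬ SkeletonEquilibrium ∨ RssProfileExists)`.
[folklore] -/
theorem lineObligation_iff (P : Prop) :
    (P → CoreGluingGivenInvertibility) ↔
      (P → CoreLinearInvertibility → (¬ SkeletonEquilibrium ∨ RssProfileExists)) := by
  rw [coreGluingGivenInvertibility_iff]

/-- … and under the Type-I DSS Liouville wall (Tsai Conj. 8.8–8.9) it is `P → CoreLinearInvertibility →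
¬ SkeletonEquilibrium`: unless `P` is itself false or refutes the linear input, the last stub of every line carries
the negation of the sibling crux stmt-15400. [folklore] -/
theorem lineObligation_iff_of_wall
    (hW : Summit.NavierStokesRegularity.NavierStokesRegularity.TypeIDSSLiouvilleConjecture) (P : Prop) :
    (P → CoreGluingGivenInvertibility) ↔ (P → CoreLinearInvertibility → ¬ SkeletonEquilibrium) := by
  constructor
  · intro h hP hL
    exact (coreGluingGivenInvertibility_iff_not_skeletonEquilibrium_of_wall hW hL).1 (h hP)
  · intro h hP hL
    exact coreGluingGivenInvertibility_of_not_skeletonEquilibrium (h hP hL) hL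

/-- A package `P` that does not mention the skeleton can enter only by refuting the linear input or by being
false: if `P` holds together with `CoreLinearInvertibility` and `SkeletonEquilibrium`, then `P → crux` is the
route TARGET itself. [folklore] -/
theorem lineObligation_iff_target_of_hyps {P : Prop} (hP : P) (hL : CoreLinearInvertibility)
    (hK1 : SkeletonEquilibrium) :
    (P → CoreGluingGivenInvertibility) ↔ RssProfileExists :=
  ⟨fun h => h hP hL hK1, fun hR _ => coreGluingGivenInvertibility_of_rssProfileExists hR⟩

/-! ## The constructive composition that exists (parent's split glue; both hypotheses crux-sized) -/

/-- Any glue `SB → TR → CoreGluing` gives the typed crux from `SB` and `TR` with the linear input idle.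
Instantiated by the tree's `Theorems.stub_coreGluingSplit` (`SelectionBox → TransverseReduction → CoreGluing`,
statements inlined; see the `example` below): this is composition 1 of the module docstring. [folklore] -/
theorem coreGluingGivenInvertibility_of_splitGlue {SB TR : Prop} (glue : SB → TR → CoreGluing)
    (hSB : SB) (hTR : TR) : CoreGluingGivenInvertibility :=
  fun _ => glue hSB hTR

/-- The tree's split glue instantiates `coreGluingGivenInvertibility_of_splitGlue`. -/
example := coreGluingGivenInvertibility_of_splitGlue stub_coreGluingSplit

end Summit.NavierStokesRegularity.NavierStokesRegularity.Cruxes.CoreGluingGivenInvertibility.Lead0
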